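import Summits.BirchSwinnertonDyer.BirchSwinnertonDyer.Theorems.CMKolyvaginAtInertTwoSilentSupplyOfPrimeTwistSupply
import Summits.BirchSwinnertonDyer.BirchSwinnertonDyer.Theorems.CMKolyvaginAtInertTwoCMPrimitiveSupplyAtInertTwoOfKolyvaginConjecture
import Summits.BirchSwinnertonDyer.BirchSwinnertonDyer.Theorems.GenusKolyvaginAtTwoGenusPrimitiveSupplyAtTwoTwistingPrime
import Summits.BirchSwinnertonDyer.BirchSwinnertonDyer.Theorems.GenusKolyvaginAtTwoMazurRubinCor34iSingleton
import Literature.NumberTheory.EllipticCurves.SelmerTrivialCorankProofs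
import Literature.NumberTheory.EllipticCurves.BSDSelmerCMPConverse
import Literature.NumberTheory.EllipticCurves.AnalyticRankOrderProofs
import HarnessLib

/-!
# Route `CMKolyvaginAtInertTwo`, crux HL′ `CMSilentHeegnerTwinSupplyAtInertTwo` (stmt-BirchSwinnertonDyer-28663) —
# HL′ IS A THEOREM (modulo two prints) ON THE SUB-HABITAT `#Sel₂(E/ℚ) = 2`:
# Mazur–Rubin twisting primes (tree THEOREMS of route `GenusKolyvaginAtTwo`) + Burungale–Tian's rank-zero `2`-converse (PRINT)

Seat `bsd-line-cmk2-p1` g23 (cell `bsd-print-cf2`), `--supports stmt-BirchSwinnertonDyer-28663` (helper; closes nothing by name).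
THEOREMS ONLY (no definition, no named fact, no `sorry`).  BSD is NOT proved by this; HL′ (all of H₂) is NOT proved by this.

THE ARGUMENT.  Let `W ∈ H₂^{HL}` (globally minimal, CM, `2` inert in the CM field `F`, `ρ̄_{E,2}` onto — so `Δ_W < 0`,
`W(ℚ)[2] = 0`, `Gal(ℚ(W[2])/ℚ) ≅ S₃`) with `#Sel₂(W/ℚ) = 2` (for `r_an = 1` curves: `Ш(W/ℚ)[2] = 0`).
1. (gk2-p4 g7, `GenusKolyTwistingPrime.exists_twistingPrime_not_selmerGroup_le_strictLocalKer`, Čebotarev PROVED in the tree)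
   there is a prime `ℓ ≡ 7 (mod 8)` with `4N_W ∣ ℓ + 1` at which `Sel₂(W)` is NOT strict (`loc_ℓ ≠ 0` on `Sel₂(W)`);
2. (gk2-p5 g6, `GenusKolyTwin.exists_heegnerField_of_prime`) `K = ℚ(√−ℓ)` is imaginary quadratic, `d_K = −ℓ` odd `≠ −3`, Heegner
   for `N_W`, `2` split;
3. (Mazur–Rubin 2010 Cor. 3.4 (i), `T = {ℓ}` — a tree THEOREM `MazurRubin2010.cor34i_singleton_rat_holds`, gk2 LEAD — through
   gk2-p5's `GenusKolyTwin.cor34i_twin_prime_heegner`) NOT strict ⟹ `#Sel₂(W) = 2·#Sel₂(W^{(d_K)})`, so `#Sel₂(W^{(d_K)}) = 1`;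
4. (`selmerCorank_eq_zero_of_natCard_selmerGroup_eq_one_factFree`) `corank_{ℤ₂} Sel_{2^∞}(W^{(d_K)}/ℚ) = 0`;
5. (**Burungale–Tian, Ann. of Math. 203 (2026) Thm. 1.1**, tree fact `burungaleTian_analyticRank_eq_zero_of_selmerCorank_eq_zero_of_hasCM`,
   ANY prime — here `p = 2` with CM field `ℚ(√−3)`, the case Rubin 1991 excludes; the twist is CM, same `j`) `r_an(W^{(d_K)}) = 0`, i.e.
   (modularity) `L(W^{(d_K)}, 1) ≠ 0`;
6. (g22 `KolyvaginLowerTwo.sum_defect_le_one_of_prime_of_cmInert_two`) `|d_K|` prime ⟹ `Σ_W(d_K) = 1`.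
Hence `K` is a SILENT HEEGNER TWIN FIELD for `W`: the conclusion of HL′.

* **`exists_silentHeegnerField_of_natCard_selmerGroup_eq_two`** — per curve: `W ∈ H₂^{HL}` (no `r_an` hypothesis needed) with
  `#Sel₂(W) = 2` ⟹ ∃ `K` as in HL′, modulo Burungale–Tian + modularity (`hasEntireLFunction_rat`).
* **`cmSilentHeegnerTwinSupply_of_burungaleTian_of_residualSupply`** — HL′ (28663) BY NAME from Burungale–Tian ∧ modularity ∧ the
  RESIDUAL algebraic supply on `{#Sel₂(W) ≠ 2}` only: «for `W ∈ H₂^{HL}` with `#Sel₂(W) ≠ 2` some prime `q`, `4N_W ∣ q + 1`, and some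
  prime `ℓ` have `corank_{ℤ_ℓ} Sel_{ℓ^∞}(W^{(−q)}/ℚ) = 0`».  So the crux HL′ is REDUCED to the sub-habitat `Ш(E/ℚ)[2] ≠ 0`
  (where one twisting prime cannot empty `Sel₂`; second-descent / Cassels–Tate control à la Smith, or `ℓ = 3` via the `3`-isogeny, would
  be the tools) — no analytic number theory is needed on `Ш(E/ℚ)[2] = 0`.

References: [MazurRubin2010] Prop. 3.3, Cor. 3.4 (i), Lemma 3.5; [BurungaleTian2026] Thm. 1.1; [GrossLMS1991] §1, §9 Prop. 9.6;
[Kramer1981] Prop. 3; [BCDTJAMS2001] Thm. A.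
-/

set_option autoImplicit false
-- the Theorems namespace of this sub repeats the summit name by design (D-0017 nested layout)
set_option linter.dupNamespace false

noncomputable section

open scoped Classical

open WeierstrassCurve NumberField Literature.NumberTheory.EllipticCurves
  Literature.NumberTheory.EllipticCurves.Rank1Residual
open Summit.BirchSwinnertonDyer.BirchSwinnertonDyer.Theses.CMKolyvaginAtInertTwo (CMSilentHeegnerTwinSupplyAtInertTwo)

namespace Summit.BirchSwinnertonDyer.BirchSwinnertonDyer.Theorems.KolyvaginLowerTwo

/-- **HL′ per curve on `#Sel₂(E) = 2`: a silent Heegner twin field EXISTS** (modulo Burungale–Tian 2026 Thm. 1.1 and modularity).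
For `W/ℚ` globally minimal with CM, `2` inert in the CM field, `ρ̄_{W,2}` onto and `#Sel₂(W/ℚ) = 2`, there is an imaginary quadratic
`K` with odd `d_K ≠ −3`, every prime of `N_W` split in `K`, one-bit genus defect `Σ_W(d_K) ≤ 1`, and `L(W^{(d_K)}, 1) ≠ 0` — namely
`K = ℚ(√−ℓ)` for a Mazur–Rubin twisting prime `ℓ ≡ 7 (mod 8)`, `4N_W ∣ ℓ + 1`, at which `Sel₂(W)` is not strict (tree theorems of
route `GenusKolyvaginAtTwo`), whose twist has `#Sel₂ = 1` (Mazur–Rubin Cor. 3.4 (i), tree theorem), hence Selmer corank `0`, hence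
analytic rank `0` (Burungale–Tian). [cite: MazurRubin2010, Cor. 3.4 (i), Prop. 3.3, Lemma 3.5] [cite: BurungaleTian2026, Thm. 1.1]
[cite: GrossLMS1991, §1 (Heegner hypothesis)] [cite: Kramer1981, Prop. 3] -/
theorem exists_silentHeegnerField_of_natCard_selmerGroup_eq_two
    (hBT : burungaleTian_analyticRank_eq_zero_of_selmerCorank_eq_zero_of_hasCM) (hmod : hasEntireLFunction_rat)
    (W : WeierstrassCurve ℚ) [W.IsElliptic] [W.IsGloballyMinimal] [NeZero (W.conductorNorm ℤ)]
    (hCM : W.HasCM) (hin : Rank1Residual.CMInert W 2) (hρ2 : W.HasSurjectiveModNGaloisRep 2)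
    (hSel : Nat.card (W.selmerGroup 2) = 2) :
    ∃ (K : Type) (_ : Field K) (_ : NumberField K), IsImaginaryQuadratic K ∧ Odd (NumberField.discr K) ∧
      NumberField.discr K ≠ -3 ∧ SatisfiesHeegnerHypothesis (W.conductorNorm ℤ) K ∧
      (∑ q ∈ (NumberField.discr K).natAbs.primeFactors,
        ((if jacobiSym W.Δ.num q = -1 then 1 else 0) + (if jacobiSym W.Δ.num q = 1 ∧ Even (W.frobeniusTrace q) then 2 else 0)) ≤ 1) ∧
      (W.quadraticTwist (NumberField.discr K : ℚ)).entireLFunction 1 ≠ 0 := by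
  have hΔ : W.Δ < 0 := KolyvaginEigenTwo.Δ_neg_of_cmInert_two W hCM hin hρ2
  have hN0 : W.conductorNorm ℤ ≠ 0 := NeZero.ne _
  have hN4 : 4 * W.conductorNorm ℤ ≠ 0 := by omega
  have hSel1 : Nat.card (W.selmerGroup 2) ≠ 1 := by rw [hSel]; norm_num
  -- 1. a Mazur–Rubin twisting prime `ℓ ≡ 7 (mod 8)`, `4N ∣ ℓ + 1`, with `Sel₂(W)` not strict at `ℓ`
  obtain ⟨ℓ, hℓF, -, -, hℓ8, hℓp, hns⟩ :=
    GenusKolyTwistingPrime.exists_twistingPrime_not_selmerGroup_le_strictLocalKer W hρ2 hΔ hSel1 hN4 0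
  have hℓ : ℓ.Prime := hℓF.out
  have hℓN' : ∀ p : ℕ, p.Prime → p ∣ W.conductorNorm ℤ → p ≠ 2 → (ℓ : ZMod p) = -1 := by
    intro p _ hp _
    have h : ((ℓ + 1 : ℕ) : ZMod p) = 0 := (ZMod.natCast_eq_zero_iff _ _).mpr (hℓp p (Dvd.dvd.mul_left hp 4))
    rw [Nat.cast_add, Nat.cast_one] at h
    exact eq_neg_of_add_eq_zero_left h
  -- 2. the prime Heegner field `K = ℚ(√−ℓ)`
  obtain ⟨-, -, K, _, _, hK, hd, hodd, hd3, hH, h2K, -, -⟩ := GenusKolyTwin.exists_heegnerField_of_prime W hℓ hℓ8 hℓN'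
  have hd0 : ((NumberField.discr K : ℤ) : ℚ) ≠ 0 := by exact_mod_cast NumberField.discr_ne_zero K
  haveI := W.isElliptic_quadraticTwist hd0
  -- 3. Mazur–Rubin Cor. 3.4 (i) (tree theorem): not strict ⟹ `#Sel₂(W) = 2·#Sel₂(W^{(d_K)})`, so the twist has `#Sel₂ = 1`
  have hcard := (GenusKolyTwin.cor34i_twin_prime_heegner W MazurRubin2010.cor34i_singleton_rat_holds hΔ hK hodd hH h2K hd
    (W.quadraticTwist ((NumberField.discr K : ℤ) : ℚ)) ⟨1, one_smul _ _⟩).2 hns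
  rw [hSel] at hcard
  have h1 : Nat.card ((W.quadraticTwist ((NumberField.discr K : ℤ) : ℚ)).selmerGroup 2) = 1 := by omega
  -- 4.–5. corank `0`, Burungale–Tian, modularity
  have h0 : (W.quadraticTwist ((NumberField.discr K : ℤ) : ℚ)).selmerCorank 2 = 0 :=
    selmerCorank_eq_zero_of_natCard_selmerGroup_eq_one_factFree (W.quadraticTwist ((NumberField.discr K : ℤ) : ℚ)) 2 h1
  have hCMd : (W.quadraticTwist ((NumberField.discr K : ℤ) : ℚ)).HasCM :=
    (hasCM_iff_of_j_eq (W.j_quadraticTwist hd0)).mpr hCM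
  have hr0 : (W.quadraticTwist ((NumberField.discr K : ℤ) : ℚ)).analyticRank = 0 :=
    hBT (W.quadraticTwist ((NumberField.discr K : ℤ) : ℚ)) hCMd 2 h0
  have hL : (W.quadraticTwist ((NumberField.discr K : ℤ) : ℚ)).entireLFunction 1 ≠ 0 :=
    ((W.quadraticTwist ((NumberField.discr K : ℤ) : ℚ)).analyticRank_eq_zero_iff_holds (hmod _)).mp hr0
  -- 6. `|d_K| = ℓ` prime ⟹ `Σ = 1 ≤ 1`
  have hq : (NumberField.discr K).natAbs.Prime := by
    rw [hd, Int.natAbs_neg, Int.natAbs_natCast]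
    exact hℓ
  exact ⟨K, _, _, hK, hodd, hd3, hH, sum_defect_le_one_of_prime_of_cmInert_two W hCM hin hρ2 K hK hodd hH hq, hL⟩

/-- **HL′ (stmt-28663) BY NAME, modulo Burungale–Tian, modularity, and the RESIDUAL supply on `{#Sel₂(E) ≠ 2}` only.**  The
hypothesis `hRest` asks, for the members of H₂^{HL} (CM, `2` inert, `ρ̄₂` onto, `r_an = 1`) whose `2`-Selmer group does NOT have
order `2` (for `r_an = 1`: those with `Ш(E/ℚ)[2] ≠ 0`), for some prime `q` with `4N_W ∣ q + 1` and some prime `ℓ` with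
`corank_{ℤ_ℓ} Sel_{ℓ^∞}(W^{(−q)}/ℚ) = 0` (the algebraic form of the pen's HL‴ there).  On `#Sel₂(W) = 2` the previous theorem
supplies the field unconditionally (mod the two prints).  HL′ itself is NOT proved: the residual supply is open.
[cite: BurungaleTian2026, Thm. 1.1] [cite: MazurRubin2010, Cor. 3.4 (i)] [cite: GrossLMS1991, §2] -/
theorem cmSilentHeegnerTwinSupply_of_burungaleTian_of_residualSupply
    (hBT : burungaleTian_analyticRank_eq_zero_of_selmerCorank_eq_zero_of_hasCM) (hmod : hasEntireLFunction_rat)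
    (hRest : ∀ (W : WeierstrassCurve ℚ) [W.IsElliptic] [W.IsGloballyMinimal] [NeZero (W.conductorNorm ℤ)],
      W.HasCM → Rank1Residual.CMInert W 2 → W.HasSurjectiveModNGaloisRep (2 : ℤ) → W.analyticRank = 1 →
      Nat.card (W.selmerGroup 2) ≠ 2 →
      ∃ q : ℕ, q.Prime ∧ (4 * W.conductorNorm ℤ : ℕ) ∣ q + 1 ∧
        ∃ ℓ : ℕ, ℓ.Prime ∧ (W.quadraticTwist (-(q : ℚ))).selmerCorank ℓ = 0) :
    CMSilentHeegnerTwinSupplyAtInertTwo := by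
  intro W _ _ _ hCM hin hρ hr
  by_cases h2 : Nat.card (W.selmerGroup 2) = 2
  · exact exists_silentHeegnerField_of_natCard_selmerGroup_eq_two hBT hmod W hCM hin hρ h2
  · obtain ⟨q, hq, hdvd, ℓ, hℓ, h0⟩ := hRest W hCM hin hρ hr h2
    have hq0 : (-(q : ℚ)) ≠ 0 := neg_ne_zero.mpr (by exact_mod_cast hq.ne_zero)
    haveI := W.isElliptic_quadraticTwist hq0
    haveI : Fact ℓ.Prime := ⟨hℓ⟩
    have hCMd : (W.quadraticTwist (-(q : ℚ))).HasCM := (hasCM_iff_of_j_eq (W.j_quadraticTwist hq0)).mpr hCM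
    have hr0 : (W.quadraticTwist (-(q : ℚ))).analyticRank = 0 := hBT (W.quadraticTwist (-(q : ℚ))) hCMd ℓ h0
    have hL : (W.quadraticTwist (-(q : ℚ))).entireLFunction 1 ≠ 0 :=
      ((W.quadraticTwist (-(q : ℚ))).analyticRank_eq_zero_iff_holds (hmod _)).mp hr0
    exact exists_silentHeegnerField_of_prime_twist W hCM hin hρ hq hdvd hL

end Summit.BirchSwinnertonDyer.BirchSwinnertonDyer.Theorems.KolyvaginLowerTwo

end
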